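import Summits.CriticalPhenomena.PercolationContinuityZ3.Theorems.Transplant.FKConnectivityAllQTwoClusterCrossNegAssoc
import Literature.Probability.Percolation.TwoSetConditionalAssociationRC
import HarnessLib

/-!
# van den Berg–Häggström–Kahn's Theorem 1.4 for the random-cluster measure `φ_{w,q}`, EVERY `q > 0` (node `FKCrossNegAssocPos`, NOT asserted):
# the `q ≥ 1` case is a theorem (vdBHK Thm. 2.1, tree), the vertex instance is the lineage's `TwoArmNegFK q`, and the `q → 0⁺` limit at fixed
# weights is the level-two node `TwoClusterCrossNegAssocPos`

Support file (`--supports stmt-CriticalPhenomena-4575`), FK sub-lane `prim-bschramm-fk-1` (gen 14) of the post-continuity programme;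
builds on p205010 (kernel theorem, internal audit signed; external expert review pending).  Definitions (the predicate `FKCrossNegAssocOn`,
`FKCrossNegAssoc`, one `@[conjecture]` node — NOT asserted), no named facts, no sorries; standard axioms.

STATEMENT (`FKCrossNegAssocOn V q`): for all weights `w`, vertices `a, c`, and monotone `F, G : Set (Sym2 V) → ℝ`,
`φ(D)·∫_D F(C_a)G(C_c) dφ ≤ (∫_D F(C_a) dφ)(∫_D G(C_c) dφ)`, `φ = φ_{w,q}` (`rcMeasureW w q ∅`), `D = {a ↮ c}`, `C_x` = open edge cluster —
"given `a ↮ c`, the clusters of `a` and `c` are negatively correlated", vdBHK Thm. 1.4 with `φ_{w,q}` for `P_w`.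
* `q ≥ 1`: a THEOREM — **`fkCrossNegAssocOn_of_one_le`**, from the tree's vdBHK Thm. 2.1 (`BHK2006_twoSetConditionalAssociation_rc`, the signed
  positive association of `(C_S, C_T)` for `q ≥ 1`) applied to `(F, −G)`; at `q = 1` it is Thm. 1.4 itself.
* `0 < q < 1`: CONJECTURAL (node `FKCrossNegAssocPos`); its vertex instance `F = 1{o ↔ a}`, `G = 1{b ↔ c}` is the lineage's node `TwoArmNegFK q`
  (fk-1 g4, `…AllQDefs.lean`; **`twoArmNegFK_of_fkCrossNegAssoc`**), one of the two inputs of Kozma–Nitzan's four-point argument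
  (`fourPointFK_of_hubCond_twoArmNeg`).  Census (fk-1 g14, exact rationals, `q ∈ {¼, ½}` (and `1, 2` as controls), all connected graphs on ≤ 5
  vertices × 3 palettes × all `(a,c)`, `F, G` over edges, edge pairs, vertices, edge∧vertex: 0 violations in 9,655,236 `(F,G)`-cells for
  each `q` (memo bschramm/FROM-fk-1-g14-EDGE-DOMINANCE.md §8); the SAME-cluster half of Thm. 2.1 fails for `q < 1` (two edges at `a`: both signs at `q = ½`).
* `q → 0⁺` at fixed `w`: `φ_{w,q}(X ∩ D) = q²·(M₂(X) + O(q))/Z` with `M₂` the two-cluster (level-2) mass (fk-1 g12 `real_mul_Z_eq_sq_mul_levelTail`),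
  so dividing the inequality by `q⁴` and letting `q → 0⁺` gives EXACTLY the level-two node `TwoClusterCrossNegAssocPos` of
  `…TwoClusterCrossNegAssoc.lean` (⇒ CA₂, FP2, edge dominance, opposite-seed NC).  (The limit is recorded here, not formalised.)
So ONE inequality — vdBHK Thm. 1.4 for `φ_{w,q}` — spans the column: theorem for `q ≥ 1`, the lineage's `TwoArmNegFKPos` for `q < 1`, and the
two-cluster corner as its `q → 0⁺` boundary.
[cite: VandenbergHaggstromKahn2005, Thm. 1.4 (p. 7); Thm. 2.1 (p. 9), eq. (12)] [cite: Grimmett2006, §1.4 eq. (1.20) (p. 15); §3.9 (pp. 63–65)]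
[cite: KozmaNitzan2024, proof of Thm. 1 (p. 8)]
-/

noncomputable section

namespace Summit.CriticalPhenomena.PercolationContinuityZ3.Theorems

namespace FK

open MeasureTheory Set Literature.Probability.LatticeModels Literature.Probability.Percolation
open scoped Classical

variable {V : Type*} [Fintype V]

/-! ### The node -/

/-- **vdBHK Theorem 1.4 for `φ_{w,q}` on the vertex type `V`**: for all weights, all `a, c` and monotone `F, G`,
`φ({a↮c})·∫_{a↮c} F(C_a)G(C_c) dφ ≤ (∫_{a↮c} F(C_a) dφ)(∫_{a↮c} G(C_c) dφ)`, `φ = rcMeasureW w q ∅`.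
[cite: VandenbergHaggstromKahn2005, Thm. 1.4 (p. 7); Thm. 2.1 (p. 9)] -/
def FKCrossNegAssocOn (V : Type*) [Fintype V] (q : ℝ) : Prop :=
  ∀ (w : Sym2 V → unitInterval) (a c : V) (F G : Set (Sym2 V) → ℝ), Monotone F → Monotone G →
    (rcMeasureW w q ∅).real (sepEv a c) *
        (∫ ω in sepEv a c, F (openEdgeCluster ω a) * G (openEdgeCluster ω c) ∂(rcMeasureW w q ∅)) ≤
      (∫ ω in sepEv a c, F (openEdgeCluster ω a) ∂(rcMeasureW w q ∅)) *
        (∫ ω in sepEv a c, G (openEdgeCluster ω c) ∂(rcMeasureW w q ∅))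

/-- **vdBHK Theorem 1.4 for `φ_{w,q}` on every finite weighted graph.** [cite: VandenbergHaggstromKahn2005, Thm. 1.4 (p. 7); Thm. 2.1 (p. 9)] -/
def FKCrossNegAssoc (q : ℝ) : Prop := ∀ n : ℕ, FKCrossNegAssocOn (Fin n) q

/-- **vdBHK Theorem 1.4 for `φ_{w,q}`, every `q > 0`.**  CONJECTURE-SHAPED STATEMENT for `0 < q < 1`, NOT asserted (a theorem for `q ≥ 1`:
`fkCrossNegAssoc_of_one_le`).  Evidence (fk-1 g14, exact): 0 violations in 9,655,236 `(F,G)`-cells for each of `q = ¼, ½` on all weighted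
graphs with ≤ 5 vertices (edge, edge-pair, vertex and edge∧vertex functionals).  Its vertex instance is `TwoArmNegFKPos`; its `q → 0⁺` limit is `TwoClusterCrossNegAssocPos`.
[cite: VandenbergHaggstromKahn2005, Thm. 1.4 (p. 7)] [cite: Grimmett2006, §3.9 (pp. 63–65)] -/
@[conjecture] def FKCrossNegAssocPos : Prop := ∀ q : ℝ, 0 < q → FKCrossNegAssoc q

/-! ### `q ≥ 1`: a theorem (vdBHK Thm. 2.1 applied to `(F, −G)`) -/

/-- **vdBHK Theorem 1.4 for `φ_{w,q}`, `q ≥ 1`** — from the tree's Theorem 2.1 (signed positive association of `(C_a, C_c)` given `{a ↮ c}`)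
with the pair `(F, −G)`, exactly as Thm. 1.4 is obtained from Thm. 1.5 in print. [cite: VandenbergHaggstromKahn2005, Thm. 2.1 (p. 9); Thm. 1.4 (p. 7)] -/
theorem fkCrossNegAssocOn_of_one_le {q : ℝ} (hq : 1 ≤ q) : FKCrossNegAssocOn V q := by
  intro w a c F G hF hG
  have key := BHK2006_twoSetConditionalAssociation_rc w hq ({a} : Set V) ({c} : Set V) (fun C _ => F C) (fun _ D => -G D)
    (fun _ => hF) (fun _ => antitone_const) (fun _ => monotone_const) (fun _ _ _ hDD' => neg_le_neg (hG hDD'))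
  simp only [Set.mem_singleton_iff, Set.iUnion_iUnion_eq_left, forall_eq] at key
  have hD : ({ω : BondConfig V | ¬ (openGraph ω).Reachable a c} : Set (BondConfig V)) = sepEv a c := rfl
  rw [hD] at key
  simp only [mul_neg, integral_neg] at key
  linarith

/-- **`FKCrossNegAssoc q` for `q ≥ 1`.** [cite: VandenbergHaggstromKahn2005, Thm. 2.1 (p. 9)] -/
theorem fkCrossNegAssoc_of_one_le {q : ℝ} (hq : 1 ≤ q) : FKCrossNegAssoc q := fun _ => fkCrossNegAssocOn_of_one_le hq

/-! ### The vertex instance: two-arm negative correlation -/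

/-- **The node read on events** (as for the level-two node): if on `D = {a ↮ c}` the functionals `F(C_a)`, `G(C_c)` are the indicators of
events `A`, `B`, then `φ(D)·φ(D ∩ A ∩ B) ≤ φ(D ∩ A)·φ(D ∩ B)`. [cite: VandenbergHaggstromKahn2005, Thm. 1.4 (p. 7); eq. (2) (p. 2)] -/
theorem real_ineq_of_fkCrossNegAssocOn {q : ℝ} (h : FKCrossNegAssocOn V q) (w : Sym2 V → unitInterval) (a c : V)
    {F G : Set (Sym2 V) → ℝ} (hF : Monotone F) (hG : Monotone G) {A B : Set (BondConfig V)}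
    (hA : EqOn (fun ω : BondConfig V => F (openEdgeCluster ω a)) (A.indicator 1) (sepEv a c))
    (hB : EqOn (fun ω : BondConfig V => G (openEdgeCluster ω c)) (B.indicator 1) (sepEv a c)) :
    (rcMeasureW w q ∅).real (sepEv a c) * (rcMeasureW w q ∅).real (sepEv a c ∩ (A ∩ B)) ≤
      (rcMeasureW w q ∅).real (sepEv a c ∩ A) * (rcMeasureW w q ∅).real (sepEv a c ∩ B) := by
  have hmD : MeasurableSet (sepEv a c : Set (BondConfig V)) := measurableSet_bond _
  have hind : ∀ S : Set (BondConfig V), ∫ ω in sepEv a c, S.indicator (1 : BondConfig V → ℝ) ω ∂(rcMeasureW w q ∅) =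
      (rcMeasureW w q ∅).real (sepEv a c ∩ S) := fun S => by
    rw [setIntegral_indicator (measurableSet_bond S)]
    simp only [Pi.one_apply, setIntegral_const, smul_eq_mul, mul_one]
  have key := h w a c F G hF hG
  have hAB : EqOn (fun ω : BondConfig V => F (openEdgeCluster ω a) * G (openEdgeCluster ω c)) ((A ∩ B).indicator 1) (sepEv a c) := by
    intro ω hω
    have h1 := hA hω
    have h2 := hB hω
    simp only at h1 h2 ⊢
    rw [h1, h2]
    exact (congrFun (Set.inter_indicator_one (s := A) (t := B) (M₀ := ℝ)) ω).symm
  rw [setIntegral_congr_fun hmD hAB, setIntegral_congr_fun hmD hA, setIntegral_congr_fun hmD hB, hind, hind, hind] at key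
  exact key

/-- **`FKCrossNegAssoc q → TwoArmNegFK q`** (`F = 1{o ↔ a}`, `G = 1{b ↔ c}`): the node contains the lineage's two-arm negative correlation
for `φ_{w,q}` (fk-1 g4), vdBHK eq. (2) for `φ_{w,q}`. [cite: VandenbergHaggstromKahn2005, eq. (2) (p. 2); Thm. 1.4 (p. 7)] -/
theorem twoArmNegFK_of_fkCrossNegAssoc {q : ℝ} (h : FKCrossNegAssoc q) : TwoArmNegFK q := by
  intro n w o a b c
  unfold TwoArmNegUnder
  have key := real_ineq_of_fkCrossNegAssocOn (h n) w a c (monotone_connIndicatorFn a o) (monotone_connIndicatorFn c b)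
    (A := openConn a o) (B := openConn c b) (fun ω _ => connIndicatorFn_openEdgeCluster ω a o) (fun ω _ => connIndicatorFn_openEdgeCluster ω c b)
  rw [openConn_comm a o, openConn_comm c b] at key
  rw [show (openConn o a ∩ openConn b c ∩ sepEv a c : Set (BondConfig (Fin n))) = sepEv a c ∩ (openConn o a ∩ openConn b c) by
      ext ω; simp only [mem_inter_iff]; tauto,
    inter_comm (openConn o a) (sepEv a c), inter_comm (openConn b c) (sepEv a c)]
  exact key

/-- **`FKCrossNegAssocPos → TwoArmNegFKPos`.** [cite: VandenbergHaggstromKahn2005, Thm. 1.4 (p. 7)] -/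
theorem twoArmNegFKPos_of_fkCrossNegAssocPos (h : FKCrossNegAssocPos) : TwoArmNegFKPos := fun q hq => twoArmNegFK_of_fkCrossNegAssoc (h q hq)

end FK

end Summit.CriticalPhenomena.PercolationContinuityZ3.Theorems

end
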